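import Mathlib.NumberTheory.ArithmeticFunction.Misc
import Mathlib.NumberTheory.Harmonic.Bounds
import Mathlib.Analysis.SpecialFunctions.Pow.Real
import Mathlib.Analysis.SpecialFunctions.Pow.Asymptotics
import Mathlib.Data.Nat.Prime.Infinite
import Mathlib.Order.Preorder.Finite
import Literature.NumberTheory.LFunctions.ColossallyAbundant
import HarnessLib

/-!
# Colossally abundant numbers: discharge of `Nat.setOf_colossallyAbundant_infinite`

Topic: `Literature/NumberTheory/LFunctions`. Sibling proof file of `ColossallyAbundant.lean`
(provefact `Literature.NumberTheory.LFunctions.robin_iff`, leaf of the DAG of Robin 1984, Thm. 1): the named fact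
`Nat.setOf_colossallyAbundant_infinite` (Alaoglu–Erdős 1944, §3: there are infinitely many
colossally abundant numbers) is proved, `Nat.setOf_colossallyAbundant_infinite_holds`.

## Proof (Alaoglu–Erdős 1944, §3, the existence part, made explicit)

Write `F_ε(m) = σ(m)/m^{1+ε}`.
* For every `ε > 0` a maximiser of `F_ε` over `m ≥ 1` exists: `σ(m)/m = ∑_{d ∣ m} 1/d ≤ H_m ≤
  1 + log m`, so `F_ε(m) ≤ (1 + log m)/m^ε → 0`, whence `F_ε(m) < 1 = F_ε(1)` for `m ≥ M₀(ε)` and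
  the maximum over the finite range `1 ≤ m < M₀` is a global maximum (`Nat.exists_isMaxOn_sigmaRpow`).
* Maximisers are unbounded: given `M`, let `m₀` maximise `σ(m)/m` over `1 ≤ m ≤ M`, take a prime
  `q > max M m₀` and `N = m₀ q`, so `σ(N)/N = (1 + 1/q) σ(m₀)/m₀`; for
  `ε = log(1 + 1/q) / (2 log N)` one has `N^ε < 1 + 1/q`, hence `F_ε(N) > σ(m₀)/m₀ ≥ F_ε(m)` for
  all `m ≤ M`, and the maximiser of `F_ε` exceeds `M` (and is `≥ 2`), i.e. is colossally abundant.

## Sources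

* L. Alaoglu, P. Erdős, *On highly composite and similar numbers*, Trans. AMS 56 (1944),
  448–469, §3 (existence of a colossally abundant number for each `ε`, and their infinitude).
  [AlaogluErdos1944]
-/

noncomputable section

open Real Finset Filter
open scoped ArithmeticFunction.sigma Topology

namespace Nat

/-! ### `σ(m)/m ≤ 1 + log m` -/

/-- `σ(m)/m = ∑_{d ∣ m} 1/d` (divisor involution `d ↦ m/d`). [folklore] -/
theorem sigma_one_div_self_eq_sum_inv {m : ℕ} (hm : m ≠ 0) :
    (σ 1 m : ℝ) / m = ∑ d ∈ m.divisors, (d : ℝ)⁻¹ := by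
  have hm0 : (m : ℝ) ≠ 0 := by exact_mod_cast hm
  rw [ArithmeticFunction.sigma_one_apply, ← Nat.sum_div_divisors m (fun d => d), Nat.cast_sum,
    Finset.sum_div]
  refine Finset.sum_congr rfl fun d hd => ?_
  have hdvd : d ∣ m := Nat.dvd_of_mem_divisors hd
  have hd0 : (d : ℝ) ≠ 0 := by exact_mod_cast (Nat.pos_of_mem_divisors hd).ne'
  rw [Nat.cast_div hdvd hd0]
  field_simp

/-- `σ(m)/m ≤ H_m ≤ 1 + log m` (Alaoglu–Erdős 1944, §3 uses the sharper Gronwall order; this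
crude bound suffices for existence). [folklore] -/
theorem sigma_one_div_self_le_one_add_log {m : ℕ} (hm : m ≠ 0) :
    (σ 1 m : ℝ) / m ≤ 1 + Real.log m := by
  rw [sigma_one_div_self_eq_sum_inv hm]
  have h1 : ∑ d ∈ m.divisors, (d : ℝ)⁻¹ ≤ ∑ d ∈ Finset.Icc 1 m, (d : ℝ)⁻¹ := by
    apply Finset.sum_le_sum_of_subset_of_nonneg
    · intro d hd
      rw [Finset.mem_Icc]
      exact ⟨Nat.pos_of_mem_divisors hd, Nat.divisor_le hd⟩
    · intro d _ _
      positivity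
  have h2 : ∑ d ∈ Finset.Icc 1 m, (d : ℝ)⁻¹ = (harmonic m : ℝ) := by
    rw [harmonic_eq_sum_Icc]
    push_cast
    rfl
  calc ∑ d ∈ m.divisors, (d : ℝ)⁻¹ ≤ ∑ d ∈ Finset.Icc 1 m, (d : ℝ)⁻¹ := h1
    _ = (harmonic m : ℝ) := h2
    _ ≤ 1 + Real.log m := harmonic_le_one_add_log m

/-! ### Maximisers of `σ(m)/m^{1+ε}` exist -/

/-- `σ(m)/m^{1+ε} = (σ(m)/m) / m^ε` for `m ≥ 1`. [folklore] -/
theorem sigma_div_rpow_eq {ε : ℝ} {m : ℕ} (hm : m ≠ 0) :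
    (σ 1 m : ℝ) / (m : ℝ) ^ (1 + ε) = ((σ 1 m : ℝ) / m) / (m : ℝ) ^ ε := by
  have hm0 : (0 : ℝ) < m := by exact_mod_cast Nat.pos_of_ne_zero hm
  rw [rpow_add hm0, rpow_one, div_div]

/-- Decay: for `ε > 0`, `σ(m)/m^{1+ε} < 1` for all large `m` (since `(1 + log m)/m^ε → 0`).
[cite: AlaogluErdos1944, §3] -/
theorem eventually_sigma_div_rpow_lt_one {ε : ℝ} (hε : 0 < ε) :
    ∃ M₀ : ℕ, ∀ m : ℕ, M₀ ≤ m → (σ 1 m : ℝ) / (m : ℝ) ^ (1 + ε) < 1 := by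
  -- `(1 + log x)/x^ε → 0` on `ℝ`
  have h1 : Tendsto (fun x : ℝ => Real.log x / x ^ ε) atTop (𝓝 0) :=
    (isLittleO_log_rpow_atTop hε).tendsto_div_nhds_zero
  have h2 : Tendsto (fun x : ℝ => x ^ (-ε)) atTop (𝓝 0) := tendsto_rpow_neg_atTop hε
  have h3 : Tendsto (fun x : ℝ => x ^ (-ε) + Real.log x / x ^ ε) atTop (𝓝 0) := by
    simpa using h2.add h1
  have h4 : ∀ᶠ x : ℝ in atTop, x ^ (-ε) + Real.log x / x ^ ε < 1 :=
    h3.eventually (gt_mem_nhds one_pos)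
  have h5 : ∀ᶠ m : ℕ in atTop, ((m : ℝ) ^ (-ε) + Real.log m / (m : ℝ) ^ ε < 1) ∧ 1 ≤ m :=
    (tendsto_natCast_atTop_atTop.eventually h4).and (eventually_ge_atTop 1)
  obtain ⟨M₀, hM₀⟩ := eventually_atTop.1 h5
  refine ⟨M₀, fun m hm => ?_⟩
  obtain ⟨hlt, hm1⟩ := hM₀ m hm
  have hm0 : m ≠ 0 := by omega
  have hmpos : (0 : ℝ) < m := by exact_mod_cast hm1
  have hpow : 0 < (m : ℝ) ^ ε := rpow_pos_of_pos hmpos ε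
  rw [sigma_div_rpow_eq hm0]
  calc (σ 1 m : ℝ) / m / (m : ℝ) ^ ε ≤ (1 + Real.log m) / (m : ℝ) ^ ε :=
        div_le_div_of_nonneg_right (sigma_one_div_self_le_one_add_log hm0) hpow.le
    _ = (m : ℝ) ^ (-ε) + Real.log m / (m : ℝ) ^ ε := by
        rw [rpow_neg hmpos.le, add_div, one_div]
    _ < 1 := hlt

/-- **Existence of a maximiser** (Alaoglu–Erdős 1944, §3): for every `ε > 0` some `n ≥ 1`
maximises `m ↦ σ(m)/m^{1+ε}` over `m ≥ 1`. [cite: AlaogluErdos1944, §3] -/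
theorem exists_isMaxOn_sigmaRpow {ε : ℝ} (hε : 0 < ε) :
    ∃ n : ℕ, 1 ≤ n ∧ ∀ m : ℕ, 1 ≤ m →
      (σ 1 m : ℝ) / (m : ℝ) ^ (1 + ε) ≤ (σ 1 n : ℝ) / (n : ℝ) ^ (1 + ε) := by
  obtain ⟨M₀, hM₀⟩ := eventually_sigma_div_rpow_lt_one hε
  set F : ℕ → ℝ := fun m => (σ 1 m : ℝ) / (m : ℝ) ^ (1 + ε) with hF
  have hF1 : F 1 = 1 := by simp [hF]
  have hne : (Finset.Icc 1 (max M₀ 1)).Nonempty := ⟨1, by simp⟩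
  obtain ⟨n, hn, hmax⟩ := Finset.exists_max_image (Finset.Icc 1 (max M₀ 1)) F hne
  rw [Finset.mem_Icc] at hn
  refine ⟨n, hn.1, fun m hm => ?_⟩
  by_cases hmM : m ≤ max M₀ 1
  · exact hmax m (Finset.mem_Icc.2 ⟨hm, hmM⟩)
  · have hlt : F m < 1 := hM₀ m (by omega)
    have h1n : F 1 ≤ F n := hmax 1 (Finset.mem_Icc.2 ⟨le_rfl, le_max_right _ _⟩)
    change F m ≤ F n
    linarith

/-! ### Colossally abundant numbers are unbounded -/

/-- **Unboundedness** (Alaoglu–Erdős 1944, §3): above every `M` there is a colossally abundant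
number. With `m₀` maximising `σ(m)/m` on `[1, M]`, a prime `q > max M m₀`, `N = m₀ q` and
`ε = log(1 + 1/q)/(2 log N)`, the number `N` beats every `m ≤ M` for `F_ε`, so the maximiser of
`F_ε` lies above `M`. [cite: AlaogluErdos1944, §3] -/
theorem exists_colossallyAbundant_gt (M : ℕ) : ∃ n : ℕ, ColossallyAbundant n ∧ M < n := by
  -- maximiser `m₀` of `σ(m)/m` on `[1, max M 1]`
  set M' : ℕ := max M 1 with hM'
  set g : ℕ → ℝ := fun m => (σ 1 m : ℝ) / m with hg
  have hne : (Finset.Icc 1 M').Nonempty := ⟨1, by simp [hM']⟩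
  obtain ⟨m₀, hm₀, hgmax⟩ := Finset.exists_max_image (Finset.Icc 1 M') g hne
  rw [Finset.mem_Icc] at hm₀
  have hm₀0 : m₀ ≠ 0 := by omega
  have hm₀pos : (0 : ℝ) < m₀ := by exact_mod_cast hm₀.1
  -- a prime `q > max M' m₀`
  obtain ⟨q, hqge, hq⟩ := Nat.exists_infinite_primes (max M' m₀ + 1)
  have hqM : M' < q := by omega
  have hqm₀ : m₀ < q := by omega
  have hq2 : 2 ≤ q := hq.two_le
  have hqpos : (0 : ℝ) < q := by exact_mod_cast hq.pos
  have hcop : Coprime m₀ q :=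
    ((Nat.Prime.coprime_iff_not_dvd hq).2 fun h => absurd (Nat.le_of_dvd hm₀.1 h) (by omega)).symm
  -- `N = m₀ q`
  set N : ℕ := m₀ * q with hN
  have hN2 : 2 ≤ N := by
    have : 1 * 2 ≤ m₀ * q := Nat.mul_le_mul hm₀.1 hq2
    simpa [hN] using this
  have hNpos : (0 : ℝ) < N := by exact_mod_cast (show 0 < N by omega)
  have hN1 : (1 : ℝ) < N := by exact_mod_cast (show 1 < N by omega)
  have hlogN : 0 < Real.log (N : ℝ) := Real.log_pos hN1
  -- `σ(N)/N = (1 + 1/q) σ(m₀)/m₀`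
  have hσq : σ 1 q = q + 1 := by
    have h := ArithmeticFunction.sigma_one_apply_prime_pow (i := 1) hq
    rw [pow_one] at h
    rw [h, Finset.sum_range_succ, Finset.sum_range_one, pow_zero, pow_one, add_comm]
  have hgN : g N = (1 + (q : ℝ)⁻¹) * g m₀ := by
    simp only [hg, hN]
    rw [ArithmeticFunction.isMultiplicative_sigma.map_mul_of_coprime hcop, hσq]
    push_cast
    field_simp
  -- the parameter
  set r : ℝ := 1 + (q : ℝ)⁻¹ with hr
  have hr1 : 1 < r := by rw [hr]; simp [hqpos]
  have hlogr : 0 < Real.log r := Real.log_pos hr1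
  set ε : ℝ := Real.log r / (2 * Real.log N) with hε
  have hεpos : 0 < ε := by positivity
  -- `N^ε < r`
  have hNε : (N : ℝ) ^ ε < r := by
    rw [rpow_def_of_pos hNpos, ← exp_log (by linarith : 0 < r), exp_lt_exp, hε]
    have : Real.log (N : ℝ) * (Real.log r / (2 * Real.log N)) = Real.log r / 2 := by field_simp
    rw [this]
    linarith
  have hNεpos : 0 < (N : ℝ) ^ ε := rpow_pos_of_pos hNpos ε
  -- `g m₀ > 0`
  have hg₀ : 0 < g m₀ := by
    simp only [hg]
    have : (1 : ℝ) ≤ σ 1 m₀ := by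
      have h1 : 1 ≤ σ 1 m₀ := by
        rw [ArithmeticFunction.sigma_one_apply]
        exact Finset.single_le_sum (fun d _ => Nat.zero_le d) (Nat.one_mem_divisors.2 hm₀0)
      exact_mod_cast h1
    positivity
  -- `F_ε(N) > g m₀`
  have hFN : g m₀ < (σ 1 N : ℝ) / (N : ℝ) ^ (1 + ε) := by
    rw [sigma_div_rpow_eq (by omega), show (σ 1 N : ℝ) / N = g N from rfl, hgN, lt_div_iff₀ hNεpos]
    calc g m₀ * (N : ℝ) ^ ε < g m₀ * r := mul_lt_mul_of_pos_left hNε hg₀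
      _ = r * g m₀ := mul_comm _ _
  -- the maximiser of `F_ε`
  obtain ⟨n, hn1, hnmax⟩ := exists_isMaxOn_sigmaRpow hεpos
  have hFn : g m₀ < (σ 1 n : ℝ) / (n : ℝ) ^ (1 + ε) := hFN.trans_le (hnmax N (by omega))
  -- `n > M'`: every `m ≤ M'` has `F_ε(m) ≤ g m ≤ g m₀`
  have hnM : M' < n := by
    by_contra hle
    have hnle : n ≤ M' := not_lt.1 hle
    have hgn : g n ≤ g m₀ := hgmax n (Finset.mem_Icc.2 ⟨hn1, hnle⟩)
    have hnpos : (0 : ℝ) < n := by exact_mod_cast hn1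
    have hn1' : (1 : ℝ) ≤ n := by exact_mod_cast hn1
    have hFle : (σ 1 n : ℝ) / (n : ℝ) ^ (1 + ε) ≤ g n := by
      rw [sigma_div_rpow_eq (by omega)]
      change g n / (n : ℝ) ^ ε ≤ g n
      have hgn0 : 0 ≤ g n := by simp only [hg]; positivity
      exact _root_.div_le_self hgn0 (one_le_rpow hn1' hεpos.le)
    linarith
  refine ⟨n, ⟨by omega, ε, hεpos, hnmax⟩, ?_⟩
  omega

/-- **Alaoglu–Erdős 1944, §3: there are infinitely many colossally abundant numbers** —
discharge of the named fact `Nat.setOf_colossallyAbundant_infinite` (`ColossallyAbundant.lean`).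
[cite: AlaogluErdos1944, §3] -/
theorem setOf_colossallyAbundant_infinite_holds : setOf_colossallyAbundant_infinite :=
  Set.infinite_of_forall_exists_gt fun M =>
    let ⟨n, hn, hlt⟩ := exists_colossallyAbundant_gt M
    ⟨n, hn, hlt⟩

/-- Hence `Nat.caSeq` is strictly increasing and enumerates the colossally abundant numbers
unconditionally. [cite: AlaogluErdos1944, §3] -/
theorem caSeq_strictMono' : StrictMono caSeq :=
  caSeq_strictMono setOf_colossallyAbundant_infinite_holds

/-- Every `caSeq k` is colossally abundant, unconditionally. [cite: AlaogluErdos1944, §3] -/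
theorem colossallyAbundant_caSeq' (k : ℕ) : ColossallyAbundant (caSeq k) :=
  colossallyAbundant_caSeq setOf_colossallyAbundant_infinite_holds k

end Nat

end
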